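import Literature.Computability.AlgebraicComplexity.TavenasVnWitness
import Literature.Computability.AlgebraicComplexity.PermanentBooleanSum
import HarnessLib

/-!
# Discharge of the Koiran–Tavenas transfer theorem

`not_isPBounded_constantFreeComplexity_perPoly_of_realTauConjecture_holds`: the named fact
`Literature.Computability.AlgebraicComplexity.not_isPBounded_constantFreeComplexity_perPoly_of_realTauConjecture`
(`TauConjecture.lean`; Tavenas 2014, Thm. 3.3 = Koiran 2011, §6: if the real τ-conjecture holds
then `τ(PER_n)` is not polynomially bounded) is a THEOREM of the tree.

The proof is Tavenas' `P`-definable route (thesis §2.2, pp. 53–54; `RealTauConjectureViaVn.lean`,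
`TavenasVnWitness.lean`): the family `V_n = ∑_{i<2^n} 2^{2i(2^n-1-i)} X^i` has `2^n - 1` distinct
real roots (`TavenasHutchinsonFamily.lean`) and coefficient bits computed by an explicit
polynomial-size circuit, so that Valiant's criterion (as an explicit formula) and Valiant's
completeness theorem for the permanent — BCS 1997, Thm. (21.27) (`BCS1997_thm_21_27_holds`,
`PermanentUniversality.lean`) and Thm. (21.29) (`BCS1997_thm_21_29_holds`,
`PermanentBooleanSum.lean`) — make its bit polynomial a projection of a polynomial-size
permanent; under `τ(PER_n) = n^{O(1)}` the proved depth-four reduction writes `V_n` as a sum of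
`n^{O(√n)}` products of `O(√n)` many `n^{O(√n)}`-sparse polynomials, contradicting the real
τ-conjecture's root bound. No counting-hierarchy or Boolean-complexity fact is used (the
original assembly through `PW_n`, `RealTauConjectureFinal.lean`, still rests on Bürgisser's
Cor. 3.9 and Lemma 2.12).

## References

* S. Tavenas, *Bornes inférieures et supérieures dans les circuits arithmétiques*, PhD thesis,
  ENS Lyon 2014, Thm. 3.3, §2.2 (Lemme 3.36, Cor. 3.37).
* P. Koiran, *Shallow circuits with high-powered inputs*, ICS 2011, §6, Thm. 7.
* P. Bürgisser, M. Clausen, M. A. Shokrollahi, *Algebraic Complexity Theory*, Springer 1997,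
  Thm. (21.27), Thm. (21.29).
-/

namespace Literature.Computability.AlgebraicComplexity

/-- **Discharge of Tavenas' Theorem 3.3** (Koiran–Tavenas transfer theorem): the real
τ-conjecture implies that `τ(PER_n)` is not polynomially bounded — unconditionally, via the
`P`-definable family `V_n` and Valiant's completeness theorem for the permanent
(`not_isPBounded_constantFreeComplexity_perPoly_of_realTauConjecture_of_BCS21_29` with
`BCS1997_thm_21_29_holds ℚ`). [cite: Tavenas2014, Thm. 3.3] -/
theorem not_isPBounded_constantFreeComplexity_perPoly_of_realTauConjecture_holds :
    not_isPBounded_constantFreeComplexity_perPoly_of_realTauConjecture :=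
  not_isPBounded_constantFreeComplexity_perPoly_of_realTauConjecture_of_BCS21_29 (BCS1997_thm_21_29_holds ℚ)

/-- The Koiran–Tavenas transfer theorem, unfolded: the real τ-conjecture implies that
`n ↦ τ(PER_n)` is not p-bounded. [cite: Tavenas2014, Thm. 3.3] -/
theorem not_isPBounded_constantFreeComplexity_perPoly_of_koiranRealTauConjecture
    (h : KoiranRealTauConjecture) :
    ¬ IsPBounded fun n => constantFreeComplexity (perPoly (Fin n) ℤ) :=
  not_isPBounded_constantFreeComplexity_perPoly_of_realTauConjecture_holds h

end Literature.Computability.AlgebraicComplexity
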